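import Literature.MathematicalPhysics.QuantumFieldTheory.OSDensityNearExplicit
import HarnessLib

/-!
# The local holomorphic density of a Schwinger function on a ball of explicit radius

Topic `Literature/MathematicalPhysics/QuantumFieldTheory`; support file (all proved; the radius as
a definition; no named facts) for the temperedness estimate (4.5) of Osterwalder–Schrader II
(Comm. Math. Phys. 42 (1975), Thm. 4.1) with exponent linear in the number of points (Ch. VI.1).
`OSDensityNearExplicit.schwinger_exists_holomorphic_density_near_explicit` produces, for `x` in the
ordered region, a local holomorphic density of `𝔖_{k+2}` on *some* ball about `cfgPt x`; its proof
uses the explicit radius `densRadius x = qsR x / (2 (max ‖L‖ Λ_L + 1))` (`L` the inverse position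
map of the explicit skeleton data at `x`, `Λ_L = cplxLBound L`). The mean-value step of Ch. VI.1
((6.6)–(6.7)) needs the radius *in the statement*, which is what this file records:

* `densRadius x hx` and `densRadius_pos`;
* `schwinger_exists_holomorphic_density_radius` — `S` holomorphic and bounded on
  `ball (cfgPt x) (densRadius x hx)`, representing `𝔖_{k+2}` on test functions supported in
  `ball x (densRadius x hx)`.

## References

* K. Osterwalder, R. Schrader, *Axioms for Euclidean Green's functions II*, Comm. Math. Phys. 42
  (1975) 281–305, Thm. 4.1; Ch. V.1; Ch. VI.1 (6.5)–(6.7). [OsterwalderSchraderCMP1975]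
-/

noncomputable section

open MeasureTheory Set Filter Module Metric Real
open _root_.Topology
open scoped InnerProductSpace RealInnerProductSpace SchwartzMap

namespace Literature.MathematicalPhysics.QuantumFieldTheory

open Literature.MathematicalPhysics.QuantumLattice (SchwingerFamily IsPositiveTimeMulti schwartzNorm)
open Literature.MathematicalPhysics.QuantumLattice.SchwingerFamily
open Literature.MathematicalPhysics.QuantumLattice.SchwingerFamily.OSSpace
open Literature.Analysis.FunctionSpaces.SchwartzAverage
open Literature.Analysis.Distribution
open Literature.Analysis.Complex
open OSFrames

variable {d : ℕ} [NeZero d]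

/-- The inverse linear position map of the explicit skeleton data at `x`. [folklore] -/
def invPosL {k : ℕ} (x : Fin (k + 2) → EuclideanSpace ℝ (Fin d)) (hx : x ∈ orderedRegion k d) :
    (Fin (k + 2) → EuclideanSpace ℝ (Fin d)) →L[ℝ] EuclideanSpace ℝ (Fin (k + 2) × Fin d) :=
  ((posLinCLE (k := k) (qsFrame x) (linearIndependent_qsFrame hx)).symm).toContinuousLinearMap

/-- **The explicit radius** `qsR x / (2 (max ‖L‖ Λ_L + 1))` of the local holomorphic density. [cite: OsterwalderSchraderCMP1975, Ch. V.1, Ch. VI.1 (6.6)] -/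
def densRadius {k : ℕ} (x : Fin (k + 2) → EuclideanSpace ℝ (Fin d)) (hx : x ∈ orderedRegion k d) : ℝ :=
  qsR x / (2 * (max ‖invPosL x hx‖ (cplxLBound (invPosL x hx)) + 1))

/-- The radius is positive. [folklore] -/
theorem densRadius_pos {k : ℕ} {x : Fin (k + 2) → EuclideanSpace ℝ (Fin d)} (hx : x ∈ orderedRegion k d) : 0 < densRadius x hx := by
  unfold densRadius
  have hM0 : 0 ≤ max ‖invPosL x hx‖ (cplxLBound (invPosL x hx)) := le_max_of_le_left (norm_nonneg _)
  have := qsR_pos hx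
  positivity

variable (𝔖 : SchwingerFamily (EuclideanSpace ℝ (Fin d))) (hE1 : 𝔖.IsEuclideanCovariant)
  (hE2 : 𝔖.IsOSReflectionPositive) {k : ℕ}
  {s : ℕ} {Cv : ℕ → ℝ} (hCv : ∀ n, 0 ≤ Cv n)
  (hv : ∀ (n : ℕ) (K : 𝓢((Fin n → EuclideanSpace ℝ (Fin d)), ℂ)) (hK : IsPositiveTimeMulti K),
    ‖ι 𝔖 hE2 (δ 𝔖 hE2 (mkGen K hK))‖ ≤ Cv n * schwartzNorm ((n + n) * s) K)
  {M : ℕ} (hM : (k + 1 + (k + 1)) * s ≤ M)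
  {s₀ : ℕ} {C₀ : ℝ} (hC₀ : 0 ≤ C₀)
  (hσ : ∀ F : 𝓢((Fin (k + 2) → EuclideanSpace ℝ (Fin d)), ℂ), ‖𝔖 (k + 2) F‖ ≤ C₀ * schwartzNorm s₀ F)

include hE1 hCv hv hM hC₀ hσ

/-- **The local holomorphic density on the ball of explicit radius**: for `x` in the ordered region
there is `S` holomorphic and bounded on `ball (cfgPt x) (densRadius x hx)` representing `𝔖_{k+2}`
on the test functions supported in `ball x (densRadius x hx)`. [cite: OsterwalderSchraderCMP1975, Thm. 4.1; Ch. V.1; Ch. VI.1 (6.5)–(6.7)] -/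
theorem schwinger_exists_holomorphic_density_radius (x : Fin (k + 2) → EuclideanSpace ℝ (Fin d))
    (hx : x ∈ orderedRegion k d) :
    ∃ S : (Fin (k + 2) → Fin d → ℂ) → ℂ,
      DifferentiableOn ℂ S (ball (cfgPt x) (densRadius x hx)) ∧ (∃ B : ℝ, ∀ ζ ∈ ball (cfgPt x) (densRadius x hx), ‖S ζ‖ ≤ B) ∧
      ∀ F : 𝓢((Fin (k + 2) → EuclideanSpace ℝ (Fin d)), ℂ),
        tsupport (F : (Fin (k + 2) → EuclideanSpace ℝ (Fin d)) → ℂ) ⊆ Metric.ball x (densRadius x hx) →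
          𝔖 (k + 2) F = ∫ y, S (cfgPt y) * F y := by
  -- base bumps of radius `r₀ = qsG x / 4` (`2 r₀ < qsG x`) and window `b = 1`
  set r₀ : ℝ := qsG x / 4 with hr₀def
  have hr₀ : 0 < r₀ := by have := qsG_pos hx; positivity
  have hr₀g : 2 * r₀ < qsG x := by have := qsG_pos hx; rw [hr₀def]; linarith
  have hb : (0 : ℝ) < 1 := one_pos
  set ê := qsFrame x with hê
  set hli : LinearIndependent ℝ ê := linearIndependent_qsFrame hx
  set ξ := qsXi x with hξ
  set U₀ := qsU0 x hli with hU₀def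
  set r := qsR x with hr
  have hr0 : 0 < r := qsR_pos hx
  obtain ⟨c, hc, hcv⟩ := exists_integral_comp_posAff ξ ê hli
  have hU₀ : posAff ξ ê hli U₀ = x := posAff_qsU0 x hli
  obtain ⟨H, hH, hB, hHT⟩ := exists_holomorphic_density_skelDist_explicit 𝔖 hE1 hE2 ξ ê hli hb (norm_qsFrame hx)
    (inner_qsFrame_nonneg hx) (qsG_le_inner_qsXi hx) hr₀g hr₀ hCv hv hM hC₀ hσ U₀ hr0 (qsR_le_tailR x hli)
    (baseIdx ê hli k hr₀) (integral_skelFamily_baseIdx ξ ê hli hr₀ hc hcv)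
  -- the inverse linear map, its complexification and the radius in configuration space
  set L : (Fin (k + 2) → EuclideanSpace ℝ (Fin d)) →L[ℝ] EuclideanSpace ℝ (Fin (k + 2) × Fin d) := invPosL x hx with hL
  have hLdef : L = ((posLinCLE (k := k) ê hli).symm).toContinuousLinearMap := rfl
  have hLx : L (x - pbase ξ) = U₀ := by
    rw [hLdef, ← hU₀, posAff, add_sub_cancel_left]
    exact (posLinCLE ê hli).symm_apply_apply U₀
  set ρ : ℝ := densRadius x hx with hρ
  have hρdef : ρ = r / (2 * (max ‖L‖ (cplxLBound L) + 1)) := rfl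
  have hM0 : 0 ≤ max ‖L‖ (cplxLBound L) := le_max_of_le_left (norm_nonneg _)
  have hρ0 : 0 < ρ := densRadius_pos hx
  have hρN : ‖L‖ * ρ < r / 2 := by
    have h1 : ‖L‖ * ρ ≤ max ‖L‖ (cplxLBound L) * ρ := mul_le_mul_of_nonneg_right (le_max_left _ _) hρ0.le
    have h2 : max ‖L‖ (cplxLBound L) * ρ < r / 2 := by
      rw [hρdef, mul_div_assoc', div_lt_div_iff₀ (by positivity) (by positivity)]
      nlinarith
    linarith
  have hρA : cplxLBound L * ρ < r / 2 := by
    have h1 : cplxLBound L * ρ ≤ max ‖L‖ (cplxLBound L) * ρ := mul_le_mul_of_nonneg_right (le_max_right _ _) hρ0.le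
    have h2 : max ‖L‖ (cplxLBound L) * ρ < r / 2 := by
      rw [hρdef, mul_div_assoc', div_lt_div_iff₀ (by positivity) (by positivity)]
      nlinarith
    linarith
  have hcentre : cplxL L (cfgPt x - cfgPt (pbase ξ)) = eRealPt U₀ := by
    rw [← cfgPt_sub, cplxL_cfgPt, hLx]
  have hmaps : MapsTo (fun ζ => cplxL L (ζ - cfgPt (pbase ξ))) (ball (cfgPt x) ρ) (ball (eRealPt U₀) (r / 2)) :=
    fun ζ hζ => by rw [← hcentre]; exact cplxL_mem_ball L hζ hρA _
  set Bd : ℝ := deconvBound (admSplit ê hli) (fun a : AdmIdx k d r₀ => regCW ξ ê (qsG x) 1 Cv M U₀ r a.1)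
    (baseIdx ê hli k hr₀) ((d + M) * (k + 2)) r with hBd
  refine ⟨fun ζ => (c : ℂ) * H (cplxL L (ζ - cfgPt (pbase ξ))), ?_, ⟨c * Bd, fun ζ hζ => ?_⟩, fun F hF => ?_⟩
  · exact (differentiableOn_const _).mul (hH.comp (differentiable_cplxL L _).differentiableOn hmaps)
  · rw [norm_mul, Complex.norm_real, Real.norm_eq_abs, abs_of_pos hc]
    exact mul_le_mul_of_nonneg_left (hB _ (hmaps hζ)) hc.le
  · have hsupp : tsupport (skelPush ξ ê hli F : EuclideanSpace ℝ (Fin (k + 2) × Fin d) → ℂ) ⊆ Metric.ball U₀ (r / 2) :=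
      (tsupport_skelPush_subset ξ ê hli hF hU₀).trans (closedBall_subset_ball hρN)
    rw [schwinger_eq_skelDist_skelPush ξ ê hli 𝔖 F, hHT _ hsupp]
    have hΦ := hcv fun y => H (eRealPt (L (y - pbase ξ))) * F y
    have hlhs : (fun U => H (eRealPt (L (posAff ξ ê hli U - pbase ξ))) * F (posAff ξ ê hli U)) =
        fun U => H (eRealPt U) * skelPush ξ ê hli F U := by
      funext U
      rw [skelPush_apply, posAff, add_sub_cancel_left, hLdef]
      erw [(posLinCLE ê hli).symm_apply_apply U]
    rw [hlhs] at hΦ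
    rw [hΦ, ← integral_const_mul]
    refine integral_congr_ae (Eventually.of_forall fun y => ?_)
    simp only
    rw [← cfgPt_sub, cplxL_cfgPt, mul_assoc]

end Literature.MathematicalPhysics.QuantumFieldTheory
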